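import Mathlib
import HarnessLib

/-!
# Shelf 1574, line `lamb_budget`: the weighted-budget (Tonelli) lemma of the slaving argument
# (part 2 of stub 1 `EnstrophySlavedToIntenseLamb`)

Helper file (`--supports stmt-NavierStokesRegularity-1574 --as helper`; director KEY-NS #114 (2)). Pure
measure theory, no Navier–Stokes: if a non-negative density `Λ` on `(t₀, t)` has CUMULATIVE bounds
`∫_{t₀}^{r} Λ ≤ K/√(T − r)` for `t₀ ≤ r ≤ t < T`, then for every exponent `0 < a < 1/2` its integral
against the integrating-factor weight `(T − s)^a` obeys

  `∫_{t₀}^{t} (T − s)^a Λ(s) ds ≤ K (T − t)^{a − 1/2} / (1 − 2a)`        (`lintegral_rpow_weight_le`)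

("Tonelli in `s` against the cumulative budget": `(T−s)^a = (T−t)^a + ∫_s^t a(T−r)^{a−1} dr`, swap the
integrals, and `∫_{t₀}^t (T−r)^{a−3/2} dr ≤ (T−t)^{a−1/2}/(1/2 − a)`). This is exactly the half power the
quarter law needs: the weight makes the `K/√(T−r)` budget integrable with the right exponent.

HONEST FRAMING: elementary real analysis; nothing about Navier–Stokes. No summit statement is proved.
-/

noncomputable section

-- the summit-side namespace repeats a component by design (D-0017)
set_option linter.dupNamespace false

namespace Summit.NavierStokesRegularity.NavierStokesRegularity.Theorems.EnstrophyQuarterLaw.LambBudget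

open Set MeasureTheory Function Metric Filter Topology
open scoped ENNReal NNReal

/-! ### Two one-variable integrals (FTC) -/

/-- `∫_s^t a (T−r)^{a−1} dr = (T−s)^a − (T−t)^a` for `s ≤ t < T`, `a > 0`. [folklore] -/
theorem integral_mul_rpow_sub_one {T a s t : ℝ} (hst : s ≤ t) (htT : t < T) :
    ∫ r in s..t, a * (T - r) ^ (a - 1) = (T - s) ^ a - (T - t) ^ a := by
  have hpos : ∀ r ∈ uIcc s t, 0 < T - r := by
    intro r hr
    rw [uIcc_of_le hst] at hr
    linarith [hr.2]
  have hderiv : ∀ r ∈ uIcc s t, HasDerivAt (fun r => -(T - r) ^ a) (a * (T - r) ^ (a - 1)) r := by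
    intro r hr
    have hTr := hpos r hr
    have h1 : HasDerivAt (fun r => T - r) (-1) r := by
      simpa using (hasDerivAt_id r).const_sub T
    have h2 := h1.rpow_const (p := a) (Or.inl hTr.ne')
    have h3 := h2.neg
    refine h3.congr_deriv ?_
    ring
  have hcont : ContinuousOn (fun r => a * (T - r) ^ (a - 1)) (uIcc s t) := by
    refine continuousOn_const.mul (ContinuousOn.rpow_const ?_ fun r hr => Or.inl (hpos r hr).ne')
    exact (continuous_const.sub continuous_id).continuousOn
  rw [intervalIntegral.integral_eq_sub_of_hasDerivAt hderiv hcont.intervalIntegrable]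
  ring

/-- `∫_{t₀}^t (T−r)^{a−3/2} dr ≤ (T−t)^{a−1/2}/(1/2−a)` for `t₀ ≤ t < T`, `a < 1/2`. [folklore] -/
theorem integral_rpow_sub_three_halves_le {T a t₀ t : ℝ} (ha : a < 1 / 2) (ht₀t : t₀ ≤ t)
    (htT : t < T) :
    ∫ r in t₀..t, (T - r) ^ (a - 3 / 2) ≤ (T - t) ^ (a - 1 / 2) / (1 / 2 - a) := by
  have hpos : ∀ r ∈ uIcc t₀ t, 0 < T - r := by
    intro r hr
    rw [uIcc_of_le ht₀t] at hr
    linarith [hr.2]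
  have hderiv : ∀ r ∈ uIcc t₀ t,
      HasDerivAt (fun r => (T - r) ^ (a - 1 / 2) / (1 / 2 - a)) ((T - r) ^ (a - 3 / 2)) r := by
    intro r hr
    have hTr := hpos r hr
    have h1 : HasDerivAt (fun r => T - r) (-1) r := by
      simpa using (hasDerivAt_id r).const_sub T
    have h2 := (h1.rpow_const (p := a - 1 / 2) (Or.inl hTr.ne')).div_const (1 / 2 - a)
    refine h2.congr_deriv ?_
    have hne : (1 / 2 - a) ≠ 0 := by linarith
    rw [show a - 1 / 2 - 1 = a - 3 / 2 by ring,
      show -1 * (a - 1 / 2) * (T - r) ^ (a - 3 / 2) / (1 / 2 - a) =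
        (T - r) ^ (a - 3 / 2) * ((1 / 2 - a) / (1 / 2 - a)) by ring, div_self hne, mul_one]
  have hcont : ContinuousOn (fun r => (T - r) ^ (a - 3 / 2)) (uIcc t₀ t) :=
    ContinuousOn.rpow_const (continuous_const.sub continuous_id).continuousOn
      fun r hr => Or.inl (hpos r hr).ne'
  rw [intervalIntegral.integral_eq_sub_of_hasDerivAt hderiv hcont.intervalIntegrable]
  have h0 : 0 ≤ (T - t₀) ^ (a - 1 / 2) / (1 / 2 - a) :=
    div_nonneg (Real.rpow_nonneg (by linarith [hpos t₀ (by simp [ht₀t])]) _) (by linarith)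
  linarith

/-! ### The weighted-budget lemma -/

/-- **Tonelli against a cumulative budget.** Let `Λ ≥ 0` be a.e.-measurable on `(t₀, t)` with
`∫_{(t₀, r)} Λ ≤ K/√(T − r)` for all `r ∈ [t₀, t]` (`0 ≤ t₀ ≤ t < T`, `K ≥ 0`), and `0 < a < 1/2`. Then
`∫_{(t₀,t)} (T − s)^a Λ(s) ds ≤ K (T − t)^{a − 1/2}/(1 − 2a)`. [folklore] -/
theorem lintegral_rpow_weight_le {Λ : ℝ → ℝ≥0∞} {T K a t₀ t : ℝ} (ha0 : 0 < a) (ha : a < 1 / 2)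
    (ht₀t : t₀ ≤ t) (htT : t < T) (hK : 0 ≤ K)
    (hΛ : AEMeasurable Λ (volume.restrict (Ioo t₀ t)))
    (hcum : ∀ r ∈ Icc t₀ t, ∫⁻ s in Ioo t₀ r, Λ s ≤ ENNReal.ofReal (K / Real.sqrt (T - r))) :
    ∫⁻ s in Ioo t₀ t, ENNReal.ofReal ((T - s) ^ a) * Λ s ≤
      ENNReal.ofReal (K * (T - t) ^ (a - 1 / 2) / (1 - 2 * a)) := by
  have hTt : 0 < T - t := sub_pos.2 htT
  set μ : Measure ℝ := volume.restrict (Ioo t₀ t) with hμ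
  -- the weight derivative `g r = a (T - r)^{a-1} ≥ 0`
  set g : ℝ → ℝ≥0∞ := fun r => ENNReal.ofReal (a * (T - r) ^ (a - 1)) with hg
  have hgm : Measurable g :=
    ENNReal.measurable_ofReal.comp (measurable_const.mul ((measurable_const.sub measurable_id).pow_const _))
  -- (1) the weight as an integral of its derivative: for `s ∈ (t₀, t)`
  have hweight : ∀ s ∈ Ioo t₀ t, ENNReal.ofReal ((T - s) ^ a) =
      ENNReal.ofReal ((T - t) ^ a) + ∫⁻ r in Ioo s t, g r := by
    intro s hs
    have hst : s ≤ t := hs.2.le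
    have hnn : ∀ r ∈ Icc s t, 0 ≤ a * (T - r) ^ (a - 1) := fun r hr =>
      mul_nonneg ha0.le (Real.rpow_nonneg (by linarith [hr.2]) _)
    have hcont : ContinuousOn (fun r => a * (T - r) ^ (a - 1)) (Icc s t) := by
      refine continuousOn_const.mul (ContinuousOn.rpow_const ?_ fun r hr => Or.inl ?_)
      · exact (continuous_const.sub continuous_id).continuousOn
      · linarith [hr.2]
    have hint : IntegrableOn (fun r => a * (T - r) ^ (a - 1)) (Ioo s t) volume :=
      (hcont.integrableOn_compact isCompact_Icc).mono_set Ioo_subset_Icc_self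
    have h1 : ∫⁻ r in Ioo s t, g r = ENNReal.ofReal (∫ r in Ioo s t, a * (T - r) ^ (a - 1)) := by
      rw [hg, ofReal_integral_eq_lintegral_ofReal hint]
      exact (ae_restrict_mem measurableSet_Ioo).mono fun r hr => hnn r (Ioo_subset_Icc_self hr)
    rw [h1, ← integral_Ioc_eq_integral_Ioo, ← intervalIntegral.integral_of_le hst,
      integral_mul_rpow_sub_one hst htT, ← ENNReal.ofReal_add (Real.rpow_nonneg hTt.le _)
        (sub_nonneg.2 (Real.rpow_le_rpow hTt.le (by linarith [hs.2]) ha0.le))]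
    congr 1; ring
  -- (2) split the weighted integral
  have hJ : ∫⁻ s in Ioo t₀ t, ENNReal.ofReal ((T - s) ^ a) * Λ s =
      ENNReal.ofReal ((T - t) ^ a) * (∫⁻ s in Ioo t₀ t, Λ s) +
        ∫⁻ s in Ioo t₀ t, (∫⁻ r in Ioo s t, g r) * Λ s := by
    rw [← lintegral_const_mul'' _ hΛ, ← lintegral_add_left' (hΛ.const_mul _)]
    refine setLIntegral_congr_fun measurableSet_Ioo (fun s hs => ?_)
    rw [hweight s hs, add_mul]
  -- (3) Tonelli on the second piece
  set Φ : ℝ → ℝ → ℝ≥0∞ := fun s r => if s < r then g r * Λ s else 0 with hΦ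
  have hΦm : AEMeasurable (uncurry Φ) (μ.prod μ) := by
    have e : uncurry Φ = {q : ℝ × ℝ | q.1 < q.2}.indicator (fun q => g q.2 * Λ q.1) := by
      funext q; simp only [hΦ, uncurry, indicator, mem_setOf_eq]
    rw [e]
    refine AEMeasurable.indicator ?_ (measurableSet_lt measurable_fst measurable_snd)
    exact (hgm.comp measurable_snd).aemeasurable.mul hΛ.comp_fst
  have hinner_s : ∀ s ∈ Ioo t₀ t, (∫⁻ r in Ioo s t, g r) * Λ s = ∫⁻ r in Ioo t₀ t, Φ s r := by
    intro s hs
    have hset : Ioo s t = Ioo t₀ t ∩ Ioi s := by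
      ext r; constructor
      · intro hr; exact ⟨⟨hs.1.trans hr.1, hr.2⟩, hr.1⟩
      · rintro ⟨hr, hrs⟩; exact ⟨hrs, hr.2⟩
    rw [← lintegral_mul_const _ hgm, hset, inter_comm, ← Measure.restrict_restrict measurableSet_Ioi,
      ← lintegral_indicator measurableSet_Ioi]
    refine lintegral_congr fun r => ?_
    simp only [hΦ, indicator, mem_Ioi]
  have hinner_r : ∀ r ∈ Ioo t₀ t, ∫⁻ s in Ioo t₀ t, Φ s r = g r * ∫⁻ s in Ioo t₀ r, Λ s := by
    intro r hr
    have hset : Ioo t₀ r = Ioo t₀ t ∩ Iio r := by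
      ext s; constructor
      · intro hs'; exact ⟨⟨hs'.1, hs'.2.trans hr.2⟩, hs'.2⟩
      · rintro ⟨hs', hsr⟩; exact ⟨hs'.1, hsr⟩
    rw [hset, inter_comm, ← Measure.restrict_restrict measurableSet_Iio,
      ← lintegral_indicator measurableSet_Iio, ← lintegral_const_mul'' _ (hΛ.indicator measurableSet_Iio)]
    refine lintegral_congr fun s => ?_
    simp only [hΦ, indicator, mem_Iio]
    split_ifs <;> simp
  have hswap : ∫⁻ s in Ioo t₀ t, (∫⁻ r in Ioo s t, g r) * Λ s =
      ∫⁻ r in Ioo t₀ t, g r * ∫⁻ s in Ioo t₀ r, Λ s := by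
    calc ∫⁻ s in Ioo t₀ t, (∫⁻ r in Ioo s t, g r) * Λ s
        = ∫⁻ s in Ioo t₀ t, ∫⁻ r in Ioo t₀ t, Φ s r := setLIntegral_congr_fun measurableSet_Ioo hinner_s
      _ = ∫⁻ r in Ioo t₀ t, ∫⁻ s in Ioo t₀ t, Φ s r := lintegral_lintegral_swap hΦm
      _ = ∫⁻ r in Ioo t₀ t, g r * ∫⁻ s in Ioo t₀ r, Λ s := setLIntegral_congr_fun measurableSet_Ioo hinner_r
  -- (4) the swapped piece against the cumulative budget
  have hha : (1 : ℝ) / 2 - a ≠ 0 := by linarith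
  have hha' : 0 < (1 : ℝ) / 2 - a := by linarith
  have h12a : (1 : ℝ) - 2 * a ≠ 0 := by linarith
  have h12a' : (1 : ℝ) - a * 2 ≠ 0 := by linarith
  have hcont2 : ContinuousOn (fun r => a * K * (T - r) ^ (a - 3 / 2)) (Icc t₀ t) := by
    refine continuousOn_const.mul (ContinuousOn.rpow_const ?_ fun r hr => Or.inl ?_)
    · exact (continuous_const.sub continuous_id).continuousOn
    · linarith [hr.2]
  have hint2 : IntegrableOn (fun r => a * K * (T - r) ^ (a - 3 / 2)) (Ioo t₀ t) volume :=
    (hcont2.integrableOn_compact isCompact_Icc).mono_set Ioo_subset_Icc_self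
  have hnn2 : 0 ≤ᵐ[volume.restrict (Ioo t₀ t)] fun r => a * K * (T - r) ^ (a - 3 / 2) :=
    (ae_restrict_mem measurableSet_Ioo).mono fun r hr =>
      mul_nonneg (mul_nonneg ha0.le hK) (Real.rpow_nonneg (by linarith [hr.2]) _)
  have h4 : ∫⁻ r in Ioo t₀ t, g r * ∫⁻ s in Ioo t₀ r, Λ s ≤
      ENNReal.ofReal (a * K * ((T - t) ^ (a - 1 / 2) / (1 / 2 - a))) := by
    calc ∫⁻ r in Ioo t₀ t, g r * ∫⁻ s in Ioo t₀ r, Λ s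
        ≤ ∫⁻ r in Ioo t₀ t, ENNReal.ofReal (a * K * (T - r) ^ (a - 3 / 2)) := by
          refine setLIntegral_mono_ae' measurableSet_Ioo (ae_of_all _ fun r hr => ?_)
          have hTr : 0 < T - r := by linarith [hr.2]
          calc g r * ∫⁻ s in Ioo t₀ r, Λ s ≤ g r * ENNReal.ofReal (K / Real.sqrt (T - r)) :=
                mul_le_mul' le_rfl (hcum r ⟨hr.1.le, hr.2.le⟩)
            _ = ENNReal.ofReal (a * K * (T - r) ^ (a - 3 / 2)) := by
                rw [hg, ← ENNReal.ofReal_mul (mul_nonneg ha0.le (Real.rpow_nonneg hTr.le _))]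
                congr 1
                rw [Real.sqrt_eq_rpow, div_eq_mul_inv, ← Real.rpow_neg hTr.le,
                  show a - 3 / 2 = (a - 1) + (-(1 / 2 : ℝ)) by ring, Real.rpow_add hTr]
                ring
      _ = ENNReal.ofReal (∫ r in Ioo t₀ t, a * K * (T - r) ^ (a - 3 / 2)) := by
          rw [ofReal_integral_eq_lintegral_ofReal hint2 hnn2]
      _ ≤ ENNReal.ofReal (a * K * ((T - t) ^ (a - 1 / 2) / (1 / 2 - a))) := by
          refine ENNReal.ofReal_le_ofReal ?_
          rw [← integral_Ioc_eq_integral_Ioo, ← intervalIntegral.integral_of_le ht₀t,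
            intervalIntegral.integral_const_mul]
          exact mul_le_mul_of_nonneg_left (integral_rpow_sub_three_halves_le ha ht₀t htT)
            (mul_nonneg ha0.le hK)
  -- (5) the first piece
  have h5 : ENNReal.ofReal ((T - t) ^ a) * (∫⁻ s in Ioo t₀ t, Λ s) ≤
      ENNReal.ofReal (K * (T - t) ^ (a - 1 / 2)) := by
    calc ENNReal.ofReal ((T - t) ^ a) * (∫⁻ s in Ioo t₀ t, Λ s)
        ≤ ENNReal.ofReal ((T - t) ^ a) * ENNReal.ofReal (K / Real.sqrt (T - t)) :=
          mul_le_mul' le_rfl (hcum t ⟨ht₀t, le_rfl⟩)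
      _ = ENNReal.ofReal (K * (T - t) ^ (a - 1 / 2)) := by
          rw [← ENNReal.ofReal_mul (Real.rpow_nonneg hTt.le _)]
          congr 1
          rw [Real.sqrt_eq_rpow, div_eq_mul_inv, ← Real.rpow_neg hTt.le,
            show a - 1 / 2 = a + (-(1 / 2 : ℝ)) by ring, Real.rpow_add hTt]
          ring
  -- (6) sum
  rw [hJ, hswap]
  have hx0 : 0 ≤ (T - t) ^ (a - 1 / 2) := Real.rpow_nonneg hTt.le _
  calc ENNReal.ofReal ((T - t) ^ a) * (∫⁻ s in Ioo t₀ t, Λ s) +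
        ∫⁻ r in Ioo t₀ t, g r * ∫⁻ s in Ioo t₀ r, Λ s
      ≤ ENNReal.ofReal (K * (T - t) ^ (a - 1 / 2)) +
          ENNReal.ofReal (a * K * ((T - t) ^ (a - 1 / 2) / (1 / 2 - a))) := add_le_add h5 h4
    _ = ENNReal.ofReal (K * (T - t) ^ (a - 1 / 2) / (1 - 2 * a)) := by
        rw [← ENNReal.ofReal_add (mul_nonneg hK hx0)
          (mul_nonneg (mul_nonneg ha0.le hK) (div_nonneg hx0 hha'.le))]
        congr 1
        field_simp
        ring

end Summit.NavierStokesRegularity.NavierStokesRegularity.Theorems.EnstrophyQuarterLaw.LambBudget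

end
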